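import Literature.NumberTheory.Automorphic.ArithmeticQuotientCohomology
import Literature.NumberTheory.Automorphic.HeckeGelfandTrick
import HarnessLib

/-!
# Hecke operators on arithmetic quotients at an unramified place: local description and
commutativity

Topic `NumberTheory/Automorphic`, namespace `Literature.NumberTheory.Automorphic.ArithmeticQuotient`;
a theorems-and-one-predicate complement to `ArithmeticQuotientCohomology` (the cohomology
`H^i(X_L, M) = H^i(Γ, Fun(𝒢 ⧸ L, M))` of the arithmetic quotient of level `L ≤ 𝒢` and its
double-coset Hecke operators `heckeFun k L g M`, `(T_g f)(xL) = ∑_{hL ⊆ LgL} f(x h L)`).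

**Setting.** A "finite place" of the (finite-adelic) group `𝒢` is modelled by a group `Gᵥ`
(think `GL_n(F_v)`) with a subgroup `Kᵥ` (think `GL_n(𝒪_v)`), an embedding `ιᵥ : Gᵥ →* 𝒢`
(`g ↦ (g at v, 1 elsewhere)`) and a retraction `πᵥ : 𝒢 →* Gᵥ` (the `v`-component) such that
elements of `𝒢` with trivial `v`-component commute with `ιᵥ(Gᵥ)`.  A level `L ≤ 𝒢` is
**unramified at `v`** (`IsUnramifiedLevel`) when `ιᵥ(Kᵥ) ≤ L` and `πᵥ(L) ≤ Kᵥ`; for a level of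
the form `L = Lᵛ × Kᵥ` (the situation of [KhareThorne2017, §6.2], "`U_v = GL_n(𝒪_{F_v})`", and of
[Scholze2015, §V.4]) both hold.  Then (all proved):

* `bijOn_localCoset` (**local–global coset correspondence**): `y Kᵥ ↦ ιᵥ(y) L` is a bijection
  from `Kᵥ a Kᵥ / Kᵥ` onto `L ιᵥ(a) L / L`; hence `heckeFun_apply_eq_sum_local`: the global Hecke
  operator `[L ιᵥ(a) L]` is the local double-coset sum `(T f)(xL) = ∑_{yKᵥ ⊆ KᵥaKᵥ} f(x ιᵥ(y) L)` —
  this is the statement "the algebra `ℋ(G(F_v), U_v)` acts on `H^*(X_U, M)`" of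
  [KhareThorne2017, §6.2] (there without proof) made precise;
* `heckeFun_comm_of_orthogonal` (**different places commute**): for two such places `v ≠ w`
  (`πw ∘ ιᵥ = 1`, `πᵥ ∘ ιw = 1`) the operators `[L ιᵥ(a) L]` and `[L ιw(b) L]` commute on
  `Fun(𝒢 ⧸ L, M)`;
* `heckeFun_comm_of_antiInvolution` (**the same place commutes**): if `Gᵥ` carries an
  anti-involution `t` with `t(Kᵥ) ⊆ Kᵥ` and `t g ∈ Kᵥ g Kᵥ` (transpose and the Cartan
  decomposition for `GL_n`, `CartanDecompositionGLn.exists_glTranspose_eq_mul_mul_adicCompletion`),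
  then `[L ιᵥ(a) L]` and `[L ιᵥ(b) L]` commute — Gelfand's trick
  (`heckeOperator_comm_apply_of_antiInvolution` of `HeckeGelfandTrick`, [Bump1997, Thm. 4.6.1])
  transported along the correspondence through the auxiliary representation of `Gᵥ` on
  `Fun(𝒢, M)` by right translation (`rightTranslationRep`), whose `Kᵥ`-fixed vectors contain the
  functions pulled back from `𝒢 ⧸ L`;
* the same statements for the Hecke operators on `H^i(X_L, M)` (`heckeOperator_comm_of_orthogonal`,
  `heckeOperator_comm_of_antiInvolution`), by functoriality of group cohomology.

These are the inputs for the commutativity of the Hecke algebras generated by the `T_{v,i}`,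
`v ∉ S`, on the cohomology of `GL_n` (module `CompletedCohomologyHeckeAlgebra`).

Also: `heckeFun_apply_mk` (the value of `T_g f` at `xL` computed with the representative `x`
rather than `(xL).out`) and `heckeFun_eq_zero_of_infinite` (the documented junk value).

## References

* C. Khare, J. Thorne, *Potential automorphy and the Leopoldt conjecture*, Amer. J. Math. 139
  (2017), §6.2 [KhareThorne2017].
* P. Scholze, *On torsion in the cohomology of locally symmetric varieties*, Ann. of Math. 182
  (2015), §V.4 [Scholze2015].
* D. Bump, *Automorphic forms and representations* (1997), Thm. 4.6.1 [Bump1997].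
-/

noncomputable section

open MulAction CategoryTheory

universe u

namespace Literature.NumberTheory.Automorphic

namespace ArithmeticQuotient

variable {k : Type u} [CommRing k] {𝒢 : Type u} [Group 𝒢] {M : Type u} [AddCommGroup M] [Module k M]

/-! ### Generalities on `heckeFun` -/

section General

variable (k M) (L : Subgroup 𝒢) (g : 𝒢)

open scoped Classical in
/-- The value of `T_g f = [L g L] f` at the coset `xL`, computed with the representative `x`:
`(T_g f)(xL) = ∑_{d ∈ LgL/L} f(x • d)` (and `0` if `LgL/L` is infinite). [folklore] -/
theorem heckeFun_apply_mk (f : (𝒢 ⧸ L) → M) (x : 𝒢) :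
    heckeFun k L g M f (x : 𝒢 ⧸ L) =
      if h : (doubleCosetQuot L g).Finite then ∑ d ∈ h.toFinset, f (x • d) else 0 := by
  rw [heckeFun_apply]
  split_ifs with h
  · obtain ⟨l, hl⟩ := QuotientGroup.mk_out_eq_mul L x
    rw [hl]
    simp_rw [mul_smul]
    exact sum_doubleCosetQuot_coe_smul h l fun d => f (x • d)
  · rfl

open scoped Classical in
/-- The documented junk value: `T_g = 0` when `LgL/L` is infinite. [folklore] -/
theorem heckeFun_eq_zero_of_infinite (h : ¬ (doubleCosetQuot L g).Finite) :
    heckeFun k L g M = 0 := by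
  refine LinearMap.ext fun f => funext fun c => ?_
  rw [heckeFun_apply, dif_neg h, LinearMap.zero_apply, Pi.zero_apply]

end General

/-! ### Unramified levels at a place -/

section Place

variable {Gᵥ : Type*} [Group Gᵥ] (Kᵥ : Subgroup Gᵥ) (ιᵥ : Gᵥ →* 𝒢) (πᵥ : 𝒢 →* Gᵥ)
  (L : Subgroup 𝒢)

/-- **A level `L ≤ 𝒢` is unramified at the place `(Gᵥ, Kᵥ, ιᵥ, πᵥ)`**: `πᵥ` is a retraction of
the embedding `ιᵥ` (`πᵥ ∘ ιᵥ = id`), elements of `𝒢` with trivial `v`-component commute with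
`ιᵥ(Gᵥ)` (automatic in a restricted product), `ιᵥ(Kᵥ) ≤ L` (the level is maximal at `v`) and
`πᵥ(L) ≤ Kᵥ` (its `v`-components are integral).  For `𝒢 = GL_n(𝔸_F^∞)`, `Gᵥ = GL_n(F_v)`,
`Kᵥ = GL_n(𝒪_v)` this says `L = Lᵛ × GL_n(𝒪_v)`, i.e. `v ∉ S` for an `S`-good level
[KhareThorne2017, §6.1–6.2]. [cite: KhareThorne2017, §6.2] -/
structure IsUnramifiedLevel : Prop where
  /-- `πᵥ ∘ ιᵥ = id`. -/
  apply_apply : ∀ y : Gᵥ, πᵥ (ιᵥ y) = y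
  /-- elements with trivial `v`-component commute with `ιᵥ(Gᵥ)`. -/
  comm_of_apply_eq_one : ∀ x : 𝒢, πᵥ x = 1 → ∀ y : Gᵥ, x * ιᵥ y = ιᵥ y * x
  /-- the level contains `ιᵥ(Kᵥ)`. -/
  map_le : Kᵥ.map ιᵥ ≤ L
  /-- the `v`-components of the level lie in `Kᵥ`. -/
  le_comap : L ≤ Kᵥ.comap πᵥ

variable {Kᵥ ιᵥ πᵥ L}

namespace IsUnramifiedLevel

variable (h : IsUnramifiedLevel Kᵥ ιᵥ πᵥ L)
include h

/-- `ιᵥ(κ) ∈ L` for `κ ∈ Kᵥ`. [folklore] -/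
theorem map_mem {κ : Gᵥ} (hκ : κ ∈ Kᵥ) : ιᵥ κ ∈ L :=
  h.map_le ⟨κ, hκ, rfl⟩

/-- `πᵥ(l) ∈ Kᵥ` for `l ∈ L`. [folklore] -/
theorem apply_mem {l : 𝒢} (hl : l ∈ L) : πᵥ l ∈ Kᵥ :=
  h.le_comap hl

/-- Every `l ∈ L` factors as `l = l₀ · ιᵥ(πᵥ l)` with `l₀ ∈ L` of trivial `v`-component.
[folklore] -/
theorem mul_inv_mem {l : 𝒢} (hl : l ∈ L) : l * (ιᵥ (πᵥ l))⁻¹ ∈ L :=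
  L.mul_mem hl (L.inv_mem (h.map_mem (h.apply_mem hl)))

/-- The `v`-component of `l · ιᵥ(πᵥ l)⁻¹` is trivial. [folklore] -/
theorem apply_mul_inv {l : 𝒢} : πᵥ (l * (ιᵥ (πᵥ l))⁻¹) = 1 := by
  rw [map_mul, map_inv, h.apply_apply, mul_inv_cancel]

/-- `l · ιᵥ(y) · L = ιᵥ(πᵥ(l) y) · L` for `l ∈ L`: left multiplication by `L` on the cosets
`ιᵥ(y) L` is left multiplication by `Kᵥ` upstairs. [folklore] -/
theorem mk_mul_map (l : 𝒢) (hl : l ∈ L) (y : Gᵥ) :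
    ((l * ιᵥ y : 𝒢) : 𝒢 ⧸ L) = ((ιᵥ (πᵥ l * y) : 𝒢) : 𝒢 ⧸ L) := by
  have hcomm := h.comm_of_apply_eq_one _ (h.apply_mul_inv (l := l)) (πᵥ l * y)
  have hl' : l * ιᵥ y = ιᵥ (πᵥ l * y) * (l * (ιᵥ (πᵥ l))⁻¹) := by
    rw [← hcomm, map_mul]
    group
  rw [hl', QuotientGroup.eq, mul_inv_rev, mul_assoc, inv_mul_cancel, mul_one]
  exact L.inv_mem (h.mul_inv_mem hl)

/-- `ιᵥ(a) L = ιᵥ(b) L ↔ a Kᵥ = b Kᵥ`. [folklore] -/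
theorem mk_map_eq_mk_map_iff (a b : Gᵥ) :
    ((ιᵥ a : 𝒢) : 𝒢 ⧸ L) = ((ιᵥ b : 𝒢) : 𝒢 ⧸ L) ↔ (a : Gᵥ ⧸ Kᵥ) = (b : Gᵥ ⧸ Kᵥ) := by
  rw [QuotientGroup.eq, QuotientGroup.eq, ← map_inv, ← map_mul]
  refine ⟨fun hab => ?_, fun hab => h.map_mem hab⟩
  simpa [h.apply_apply] using h.apply_mem hab

/-- **The local–global coset map** `Gᵥ ⧸ Kᵥ → 𝒢 ⧸ L`, `y Kᵥ ↦ ιᵥ(y) L` (well defined as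
`ιᵥ(Kᵥ) ≤ L`). [folklore] -/
def localCoset : Gᵥ ⧸ Kᵥ → 𝒢 ⧸ L :=
  Quotient.map' ιᵥ fun a b hab => by
    rw [QuotientGroup.leftRel_apply] at hab ⊢
    rw [← map_inv, ← map_mul]
    exact h.map_mem hab

/-- `localCoset (y Kᵥ) = ιᵥ(y) L`. [folklore] -/
@[simp]
theorem localCoset_mk (y : Gᵥ) : h.localCoset (y : Gᵥ ⧸ Kᵥ) = ((ιᵥ y : 𝒢) : 𝒢 ⧸ L) :=
  rfl

/-- `localCoset` is injective (`πᵥ(L) ≤ Kᵥ`). [folklore] -/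
theorem localCoset_injective : Function.Injective h.localCoset := by
  intro a b hab
  induction a using QuotientGroup.induction_on
  induction b using QuotientGroup.induction_on
  rwa [localCoset_mk, localCoset_mk, h.mk_map_eq_mk_map_iff] at hab

/-- **Local–global coset correspondence**: `y Kᵥ ↦ ιᵥ(y) L` is a bijection from
`Kᵥ a Kᵥ / Kᵥ` onto `L ιᵥ(a) L / L` ([KhareThorne2017, §6.2]: the double cosets of the local
Hecke algebra `ℋ(G(F_v), U_v)` inside `𝒢` when `U_v = GL_n(𝒪_v)`). [cite: KhareThorne2017, §6.2] -/
theorem bijOn_localCoset (a : Gᵥ) :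
    Set.BijOn h.localCoset (orbit Kᵥ (a : Gᵥ ⧸ Kᵥ)) (doubleCosetQuot L (ιᵥ a)) := by
  refine ⟨?_, h.localCoset_injective.injOn, ?_⟩
  · rintro _ ⟨κ, rfl⟩
    refine ⟨⟨ιᵥ κ, h.map_mem κ.2⟩, ?_⟩
    change ((ιᵥ κ * ιᵥ a : 𝒢) : 𝒢 ⧸ L) = h.localCoset (((κ : Gᵥ) * a : Gᵥ) : Gᵥ ⧸ Kᵥ)
    rw [localCoset_mk, map_mul]
  · rintro _ ⟨l, rfl⟩
    refine ⟨((πᵥ l * a : Gᵥ) : Gᵥ ⧸ Kᵥ), ⟨⟨πᵥ l, h.apply_mem l.2⟩, rfl⟩, ?_⟩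
    rw [localCoset_mk]
    exact (h.mk_mul_map l l.2 a).symm

/-- The global double coset `L ιᵥ(a) L / L` is finite iff the local one `Kᵥ a Kᵥ / Kᵥ` is.
[folklore] -/
theorem finite_doubleCosetQuot_iff (a : Gᵥ) :
    (doubleCosetQuot L (ιᵥ a)).Finite ↔ (orbit Kᵥ (a : Gᵥ ⧸ Kᵥ)).Finite :=
  ⟨fun hf => Set.Finite.of_finite_image (by rwa [(h.bijOn_localCoset a).image_eq])
      (h.bijOn_localCoset a).injOn,
    fun hf => by rw [← (h.bijOn_localCoset a).image_eq]; exact hf.image _⟩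

open scoped Classical in
/-- **The global Hecke operator is the local double-coset sum**: for `L` unramified at `v` and
`Kᵥ a Kᵥ / Kᵥ` finite, `([L ιᵥ(a) L] f)(xL) = ∑_{y Kᵥ ⊆ Kᵥ a Kᵥ} f(x ιᵥ(y) L)`, the sum over
the local orbit with `Quotient.out` representatives ([KhareThorne2017, §6.2]: the action of
`ℋ(G(F_v), U_v)` on `H^*(X_U, M)`). [cite: KhareThorne2017, §6.2] -/
theorem heckeFun_apply_eq_sum_local {a : Gᵥ} (ha : (orbit Kᵥ (a : Gᵥ ⧸ Kᵥ)).Finite)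
    (f : (𝒢 ⧸ L) → M) (x : 𝒢) :
    heckeFun k L (ιᵥ a) M f (x : 𝒢 ⧸ L) =
      ∑ y ∈ ha.toFinset, f ((x * ιᵥ y.out : 𝒢) : 𝒢 ⧸ L) := by
  have hfin : (doubleCosetQuot L (ιᵥ a)).Finite := (h.finite_doubleCosetQuot_iff a).2 ha
  rw [heckeFun_apply_mk, dif_pos hfin]
  symm
  refine Finset.sum_nbij h.localCoset (fun y hy => ?_) (fun y _ z _ hyz => h.localCoset_injective hyz)
    (fun d hd => ?_) (fun y _ => ?_)
  · rw [Set.Finite.mem_toFinset] at hy ⊢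
    exact (h.bijOn_localCoset a).mapsTo hy
  · rw [Finset.mem_coe, Set.Finite.mem_toFinset] at hd
    obtain ⟨y, hy, rfl⟩ := (h.bijOn_localCoset a).surjOn hd
    exact ⟨y, by rwa [Finset.mem_coe, Set.Finite.mem_toFinset], rfl⟩
  · conv_rhs => rw [← QuotientGroup.out_eq' y]
    rw [localCoset_mk]
    rfl

end IsUnramifiedLevel

/-! ### Different places commute -/

section Orthogonal

variable {G₁ G₂ : Type*} [Group G₁] [Group G₂] {K₁ : Subgroup G₁} {K₂ : Subgroup G₂}
  {ι₁ : G₁ →* 𝒢} {π₁ : 𝒢 →* G₁} {ι₂ : G₂ →* 𝒢} {π₂ : 𝒢 →* G₂} {L : Subgroup 𝒢}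

variable (k M) in
/-- **Hecke operators at two different unramified places commute** on `Fun(𝒢 ⧸ L, M)`:
if `L` is unramified at `v₁` and at `v₂` and the two places are orthogonal
(`π₂ ∘ ι₁ = 1`, so that `ι₁(G₁)` and `ι₂(G₂)` commute elementwise), then
`[L ι₁(a) L] ∘ [L ι₂(b) L] = [L ι₂(b) L] ∘ [L ι₁(a) L]`; the double sums
`∑_y ∑_z f(x ι₁(y) ι₂(z) L)` agree term by term since `ι₁(y)` and `ι₂(z)` commute. [folklore] -/
theorem heckeFun_comm_of_orthogonal (h₁ : IsUnramifiedLevel K₁ ι₁ π₁ L)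
    (h₂ : IsUnramifiedLevel K₂ ι₂ π₂ L) (horth : ∀ y : G₁, π₂ (ι₁ y) = 1) (a : G₁) (b : G₂) :
    heckeFun k L (ι₁ a) M ∘ₗ heckeFun k L (ι₂ b) M =
      heckeFun k L (ι₂ b) M ∘ₗ heckeFun k L (ι₁ a) M := by
  classical
  by_cases ha : (orbit K₁ (a : G₁ ⧸ K₁)).Finite
  swap
  · rw [heckeFun_eq_zero_of_infinite k M L (ι₁ a) (mt (h₁.finite_doubleCosetQuot_iff a).1 ha),
      LinearMap.zero_comp, LinearMap.comp_zero]
  by_cases hb : (orbit K₂ (b : G₂ ⧸ K₂)).Finite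
  swap
  · rw [heckeFun_eq_zero_of_infinite k M L (ι₂ b) (mt (h₂.finite_doubleCosetQuot_iff b).1 hb),
      LinearMap.zero_comp, LinearMap.comp_zero]
  refine LinearMap.ext fun f => funext fun c => ?_
  induction c using QuotientGroup.induction_on with
  | H x =>
    simp only [LinearMap.comp_apply]
    rw [h₁.heckeFun_apply_eq_sum_local ha, h₂.heckeFun_apply_eq_sum_local hb]
    simp_rw [h₂.heckeFun_apply_eq_sum_local hb, h₁.heckeFun_apply_eq_sum_local ha]
    rw [Finset.sum_comm]
    refine Finset.sum_congr rfl fun z _ => Finset.sum_congr rfl fun y _ => ?_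
    rw [mul_assoc, mul_assoc, h₂.comm_of_apply_eq_one _ (horth y.out) z.out]

end Orthogonal

/-! ### The same place commutes: Gelfand's trick -/

section SamePlace

variable (k M) (ιᵥ)

/-- The auxiliary representation of `Gᵥ` on all functions `𝒢 → M` by right translation through
`ιᵥ`: `(ρ(y) F)(x) = F(x ιᵥ(y))`.  Functions pulled back from `𝒢 ⧸ L` are `Kᵥ`-fixed when
`ιᵥ(Kᵥ) ≤ L`, and on them the Hecke operators of `HeckeAlgebra` (`heckeOperator ρ Kᵥ a`) are the
global operators `[L ιᵥ(a) L]` (`heckeOperator_rightTranslationRep_comp_mk`). [folklore] -/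
def rightTranslationRep : Representation k Gᵥ (𝒢 → M) where
  toFun y := LinearMap.funLeft k M fun x : 𝒢 => x * ιᵥ y
  map_one' := by
    ext F x
    simp
  map_mul' y y' := by
    ext F x
    simp [mul_assoc]

/-- Unfolding lemma: `(ρ(y) F)(x) = F(x ιᵥ(y))`. [folklore] -/
@[simp]
theorem rightTranslationRep_apply (y : Gᵥ) (F : 𝒢 → M) (x : 𝒢) :
    rightTranslationRep k M ιᵥ y F x = F (x * ιᵥ y) :=
  rfl

variable {k M ιᵥ}

/-- A function pulled back from `𝒢 ⧸ L` is `Kᵥ`-fixed for the right-translation representation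
when `ιᵥ(Kᵥ) ≤ L`. [folklore] -/
theorem comp_mk_mem_fixedPoints (hle : Kᵥ.map ιᵥ ≤ L) (f : (𝒢 ⧸ L) → M) :
    (f ∘ (QuotientGroup.mk : 𝒢 → 𝒢 ⧸ L)) ∈ (rightTranslationRep k M ιᵥ).fixedPoints Kᵥ := by
  rw [Representation.mem_fixedPoints]
  intro κ hκ
  funext x
  simp only [rightTranslationRep_apply, Function.comp_apply]
  congr 1
  rw [QuotientGroup.eq]
  simpa using hle ⟨κ, hκ, rfl⟩

open scoped Classical in
/-- On functions pulled back from `𝒢 ⧸ L` (for `L` unramified at `v`), the concrete Hecke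
operator `heckeOperator ρ Kᵥ a = ∑_{yKᵥ ⊆ KᵥaKᵥ} ρ(y)` of the right-translation representation is
the global double-coset operator `[L ιᵥ(a) L]`:
`[KᵥaKᵥ] (f ∘ mk) = ([L ιᵥ(a) L] f) ∘ mk`. [cite: KhareThorne2017, §6.2] -/
theorem heckeOperator_rightTranslationRep_comp_mk (h : IsUnramifiedLevel Kᵥ ιᵥ πᵥ L) {a : Gᵥ}
    (ha : (orbit Kᵥ (a : Gᵥ ⧸ Kᵥ)).Finite) (f : (𝒢 ⧸ L) → M) :
    Literature.NumberTheory.Automorphic.heckeOperator (rightTranslationRep k M ιᵥ) Kᵥ a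
        (f ∘ (QuotientGroup.mk : 𝒢 → 𝒢 ⧸ L)) =
      (heckeFun k L (ιᵥ a) M f) ∘ (QuotientGroup.mk : 𝒢 → 𝒢 ⧸ L) := by
  funext x
  rw [Literature.NumberTheory.Automorphic.heckeOperator, finsum_mem_eq_finite_toFinset_sum _ ha,
    LinearMap.sum_apply, Finset.sum_apply, Function.comp_apply, h.heckeFun_apply_eq_sum_local ha]
  rfl

variable (k M) in
/-- **Hecke operators at one unramified place commute (Gelfand's trick).**  Let `L` be unramified
at `v` and let `t = unop ∘ τ` be an anti-involution of `Gᵥ` with `t(Kᵥ) ⊆ Kᵥ` and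
`t g ∈ Kᵥ g Kᵥ` for all `g` (for `GL_n(F_v)`: the transpose and the Cartan decomposition).  Then
`[L ιᵥ(a) L] ∘ [L ιᵥ(b) L] = [L ιᵥ(b) L] ∘ [L ιᵥ(a) L]` on `Fun(𝒢 ⧸ L, M)`: both sides, pulled
back to `Fun(𝒢, M)`, are products of Hecke operators of the right-translation representation on a
`Kᵥ`-fixed vector, which commute by `heckeOperator_comm_apply_of_antiInvolution`
([Bump1997, Thm. 4.6.1]; the commutativity of the spherical Hecke algebra). [cite: Bump1997, Thm. 4.6.1] -/
theorem heckeFun_comm_of_antiInvolution (h : IsUnramifiedLevel Kᵥ ιᵥ πᵥ L) (τ : Gᵥ ≃* Gᵥᵐᵒᵖ)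
    (hτK : ∀ κ ∈ Kᵥ, (τ κ).unop ∈ Kᵥ) (hτ2 : ∀ g : Gᵥ, (τ (τ g).unop).unop = g)
    (hcoset : ∀ g : Gᵥ, ∃ k₁ ∈ Kᵥ, ∃ k₂ ∈ Kᵥ, (τ g).unop = k₁ * g * k₂) (a b : Gᵥ) :
    heckeFun k L (ιᵥ a) M ∘ₗ heckeFun k L (ιᵥ b) M =
      heckeFun k L (ιᵥ b) M ∘ₗ heckeFun k L (ιᵥ a) M := by
  classical
  by_cases ha : (orbit Kᵥ (a : Gᵥ ⧸ Kᵥ)).Finite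
  swap
  · rw [heckeFun_eq_zero_of_infinite k M L (ιᵥ a) (mt (h.finite_doubleCosetQuot_iff a).1 ha),
      LinearMap.zero_comp, LinearMap.comp_zero]
  by_cases hb : (orbit Kᵥ (b : Gᵥ ⧸ Kᵥ)).Finite
  swap
  · rw [heckeFun_eq_zero_of_infinite k M L (ιᵥ b) (mt (h.finite_doubleCosetQuot_iff b).1 hb),
      LinearMap.zero_comp, LinearMap.comp_zero]
  refine LinearMap.ext fun f => ?_
  -- compare the pull-backs to `Fun(𝒢, M)`, where both sides are iterated local Hecke operators
  have hinj : Function.Injective fun g : (𝒢 ⧸ L) → M => g ∘ (QuotientGroup.mk : 𝒢 → 𝒢 ⧸ L) :=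
    fun g g' hgg' => funext fun c => QuotientGroup.induction_on c fun x => congr_fun hgg' x
  apply hinj
  set ρ := rightTranslationRep k M ιᵥ
  have hf := comp_mk_mem_fixedPoints (k := k) h.map_le f
  simp only [LinearMap.comp_apply]
  rw [← heckeOperator_rightTranslationRep_comp_mk h ha, ← heckeOperator_rightTranslationRep_comp_mk h hb,
    ← heckeOperator_rightTranslationRep_comp_mk h hb, ← heckeOperator_rightTranslationRep_comp_mk h ha]
  exact heckeOperator_comm_apply_of_antiInvolution ρ Kᵥ τ hτK hτ2 (M := ⊤) le_top
    (fun g _ => hcoset g) (Subgroup.mem_top a) (Subgroup.mem_top b) ha hb hf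

end SamePlace

/-! ### Consequences for the Hecke operators on `H^i(X_L, M)` -/

section Cohomology

variable {Γ : Type u} [Group Γ] (ι : Γ →* 𝒢) {L : Subgroup 𝒢}

variable (k M) in
/-- Commuting Hecke operators on `Fun(𝒢 ⧸ L, M)` give commuting endomorphisms of the coefficient
representation. [folklore] -/
theorem heckeRepHom_comm {g g' : 𝒢}
    (hc : heckeFun k L g M ∘ₗ heckeFun k L g' M = heckeFun k L g' M ∘ₗ heckeFun k L g M) :
    heckeRepHom k L g' M ι ≫ heckeRepHom k L g M ι = heckeRepHom k L g M ι ≫ heckeRepHom k L g' M ι :=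
  Rep.hom_ext (Representation.IntertwiningMap.ext hc)

variable (k M) in
/-- Commuting Hecke operators on `Fun(𝒢 ⧸ L, M)` give commuting Hecke operators on `H^i(X_L, M)`
(functoriality of group cohomology). [folklore] -/
theorem heckeOperator_comm {g g' : 𝒢}
    (hc : heckeFun k L g M ∘ₗ heckeFun k L g' M = heckeFun k L g' M ∘ₗ heckeFun k L g M) (i : ℕ) :
    heckeOperator k L g' M ι i ≫ heckeOperator k L g M ι i =
      heckeOperator k L g M ι i ≫ heckeOperator k L g' M ι i := by
  rw [heckeOperator, heckeOperator, ← groupCohomology.map_id_comp, heckeRepHom_comm k M ι hc,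
    groupCohomology.map_id_comp]

variable {G₁ G₂ : Type*} [Group G₁] [Group G₂] {K₁ : Subgroup G₁} {K₂ : Subgroup G₂}
  {ι₁ : G₁ →* 𝒢} {π₁ : 𝒢 →* G₁} {ι₂ : G₂ →* 𝒢} {π₂ : 𝒢 →* G₂}

variable (k M) in
/-- **Hecke operators on `H^i(X_L, M)` at two different unramified places commute.**
[folklore] -/
theorem heckeOperator_comm_of_orthogonal (h₁ : IsUnramifiedLevel K₁ ι₁ π₁ L)
    (h₂ : IsUnramifiedLevel K₂ ι₂ π₂ L) (horth : ∀ y : G₁, π₂ (ι₁ y) = 1) (a : G₁) (b : G₂)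
    (i : ℕ) :
    heckeOperator k L (ι₂ b) M ι i ≫ heckeOperator k L (ι₁ a) M ι i =
      heckeOperator k L (ι₁ a) M ι i ≫ heckeOperator k L (ι₂ b) M ι i :=
  heckeOperator_comm k M ι (heckeFun_comm_of_orthogonal k M h₁ h₂ horth a b) i

variable {Gᵥ : Type*} [Group Gᵥ] {Kᵥ : Subgroup Gᵥ} {ιᵥ : Gᵥ →* 𝒢} {πᵥ : 𝒢 →* Gᵥ}

variable (k M) in
/-- **Hecke operators on `H^i(X_L, M)` at one unramified place commute** (Gelfand's trick).
[cite: Bump1997, Thm. 4.6.1] -/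
theorem heckeOperator_comm_of_antiInvolution (h : IsUnramifiedLevel Kᵥ ιᵥ πᵥ L)
    (τ : Gᵥ ≃* Gᵥᵐᵒᵖ) (hτK : ∀ κ ∈ Kᵥ, (τ κ).unop ∈ Kᵥ)
    (hτ2 : ∀ g : Gᵥ, (τ (τ g).unop).unop = g)
    (hcoset : ∀ g : Gᵥ, ∃ k₁ ∈ Kᵥ, ∃ k₂ ∈ Kᵥ, (τ g).unop = k₁ * g * k₂) (a b : Gᵥ) (i : ℕ) :
    heckeOperator k L (ιᵥ b) M ι i ≫ heckeOperator k L (ιᵥ a) M ι i =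
      heckeOperator k L (ιᵥ a) M ι i ≫ heckeOperator k L (ιᵥ b) M ι i :=
  heckeOperator_comm k M ι (heckeFun_comm_of_antiInvolution k M h τ hτK hτ2 hcoset a b) i

end Cohomology

end Place

end ArithmeticQuotient

end Literature.NumberTheory.Automorphic
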